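import Summits.BirchSwinnertonDyer.BirchSwinnertonDyer.Theorems.PrintCf2RubinValueTwoVLineSupplySeed
import Summits.BirchSwinnertonDyer.BirchSwinnertonDyer.Theorems.PrintCf2RubinValueTwoKatzPeriodRigidityDA7
import Summits.BirchSwinnertonDyer.BirchSwinnertonDyer.Theorems.PrintCf2SplitBadTwoFrameFieldArithmetic
import Summits.BirchSwinnertonDyer.BirchSwinnertonDyer.Theorems.PrintCf2SplitBadTwoQuadraticPartAvatar
import Summits.BirchSwinnertonDyer.BirchSwinnertonDyer.Theorems.PrintCf2SplitBadTwoQuadraticSignRamification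
import Summits.BirchSwinnertonDyer.BirchSwinnertonDyer.Theorems.PrintCf2RubinValueTwoLinePinVLineCharIdeal
import Literature.NumberTheory.EllipticCurves.DeShalit1987.KatzPAdicLFunctionFunctionalEquation
import Literature.NumberTheory.EllipticCurves.Muller2020.MainConjectureSplitTwo
import HarnessLib

/-!
# THE `v`-LINE INTERPOLATION SUPPLY FOR EVERY QUADRATIC BRANCH AT THE SPLIT PRIME `2` OF `ℚ(√−7)` — ramified at `v` or not — FILE 2: the
# assembly (crux `stmt-BirchSwinnertonDyer-24086` `PrintCf2RubinValueTwo.MainConjClauseAtSplitTwoQuad`, line `m_line_pin`, stub (A)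
# `stub_vLineRestriction`: the in-range points on the line `T₂ = 0` that period rigidity / the Euler-factor comparison read; also stub (T))

Cell `bsd-print-cf2`, width seat `bsd-line-cf2c-w3` g6; Theses-free; `--supports stmt-BirchSwinnertonDyer-24033` (helper).  THEOREMS ONLY
(no `def`, no named fact, no `sorry`).  FILE 2 of 2 (file 1 = `…VLineSupplySeed`).

* §3 **`exists_vLineSupply`** — for EVERY quadratic `θ_K` (all four classes of `θ_K|ℤ₂ˣ ∈ {1, χ₈, χ₄, χ₈′}`, parity absorbed): characters
  `ρ t = Ψᵗ·η` (`η ∈ {ω_A⁻², ω_A⁻¹ω_B⁻¹, ω_A⁻¹, ω_B⁻¹}` the matched B18s seed of cruxlead-23721 g3, `Ψ = ω_A⁻²` of type `(−2,0)` UNRAMIFIED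
  EVERYWHERE — no class-number-one character is needed) with avatars `r t` through `κ₁`, `r t (γ₁⁻¹) = w·uᵗ`, `r t (γ₂⁻¹) = 1`, `‖w − 1‖ < 1`,
  `‖u − 1‖ < ‖2‖`, `u ≠ 1` (no root of unity), `θ_K⁻¹ρ_t` of type `(−(m₀ + 2t), 0)` with `m₀ ∈ {1, 2}`, `ρ_t` unramified off `v`, `θ_K⁻¹ρ_t`
  UNRAMIFIED AT `v`, entire `L`.
* §4 the DA7 binder currency of `m_line_pin` (`d_K = −7`, a framed quadratic `θ` with Hecke avatar `θ_K`, `θ_K² = 1` by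
  `KatzPeriodRigidity.mul_self_eq_one_of_isHeckeCharOf_quadratic`): **`exists_vLineSupply_of_discr`**.
* §5 consumer forms: `isUnramifiedAt_of_modulus` (the `hunr` of `IsNuBranch.hasValueAt` for any modulus `T ∌ v` ⊇ ramification of `θ_K` off
  `v`), `isNuBranch_map_constantCoeff_of_pair` (`π_v G₂ = G₂.map constantCoeff` of a two-variable frame at the inverse generators IS a `ν`-branch
  of modulus `S ∪ {v̄}`) — stub (A)'s `(π_v G₂) = E·(G₁)` and stub (T)'s pseudo-branch
  comparison are read at ONE family of nodes `w·uᵗ − 1` for BOTH series, with no hypothesis «θ_K unramified at v».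

HONEST FRAMING: plumbing over cruxlead-23721 g3's B18s files and file 1; it removes the scope restriction «θ_K unramified at v» from the
(A)/(T) analytic comparisons of line `m_line_pin`; closes nothing by itself; beyond-print theorem: no.  BSD is not proved by any of this.

References: [deShalit1987] II.4.12, II.4.16 (49)–(50), II.4.17 (52)–(54); [Muller2020SplitPrimeTwo] Thm. 2.4, Def. 2.5;
[SerreAbelianLadic1968] Ch. II §2.7; [Washington1997] §13.1 Thm. 13.4; [CastellaGrossiLeeSkinner2022] Thm. 2.1.2.
-/


-- the summit namespace `Summit.BirchSwinnertonDyer.BirchSwinnertonDyer` repeats the problem name by design (D-0017)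
set_option linter.dupNamespace false
set_option autoImplicit false

noncomputable section

open scoped Classical

open NumberField IsDedekindDomain Field Filter Literature.NumberTheory.GaloisRepresentations
  Literature.NumberTheory.EllipticCurves Literature.NumberTheory.EllipticCurves.Rank1Residual
  Summit.BirchSwinnertonDyer.BirchSwinnertonDyer.Theorems.PrintCf2
  Summit.BirchSwinnertonDyer.BirchSwinnertonDyer.Theorems.PrintCf2.FrameSeed

open Summit.BirchSwinnertonDyer.BirchSwinnertonDyer.Theorems.PrintCf2.VLineSupplySeed

namespace Summit.BirchSwinnertonDyer.BirchSwinnertonDyer.Theorems.PrintCf2.VLineSupply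

variable {K : Type} [Field K] [NumberField K]
/-- `χ₈, χ₈'` at `±1, ±5 ∈ ℤ/8`. [folklore] -/
private theorem chi_table :
    ZMod.χ₈ (1 : ZMod (2 ^ 3)) = 1 ∧ ZMod.χ₈ (-1 : ZMod (2 ^ 3)) = 1 ∧ ZMod.χ₈ (5 : ZMod (2 ^ 3)) = -1 ∧ ZMod.χ₈ (-5 : ZMod (2 ^ 3)) = -1 ∧
    ZMod.χ₈' (1 : ZMod (2 ^ 3)) = 1 ∧ ZMod.χ₈' (-1 : ZMod (2 ^ 3)) = -1 ∧ ZMod.χ₈' (5 : ZMod (2 ^ 3)) = -1 ∧ ZMod.χ₈' (-5 : ZMod (2 ^ 3)) = 1 := by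
  decide

/-- The odd characters `χ₄ = χ₈χ₈'` and `χ₈'` of `(ℤ/8)ˣ` take the value `−1` at `−1`. [folklore] -/
private theorem chi_odd : (ZMod.χ₈ * ZMod.χ₈') (-1 : ZMod 8) = -1 ∧ ZMod.χ₈' (-1 : ZMod 8) = -1 := by decide

/-- `(χ₈χ₈')(x) = χ₈(x)χ₈'(x)`. [folklore] -/
private theorem chi4_apply (x : ZMod 8) : (ZMod.χ₈ * ZMod.χ₈') x = ZMod.χ₈ x * ZMod.χ₈' x := rfl

/-! ## §3 (continued) The supply for every quadratic `θ_K` -/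
open Summit.BirchSwinnertonDyer.Rank1Residual.X11b.LambdaSupply
  Summit.BirchSwinnertonDyer.Rank1Residual.X11b.Three.LambdaSupply

/-- **THE `v`-LINE INTERPOLATION SUPPLY FOR EVERY QUADRATIC `θ_K` (core form).**  `K` imaginary quadratic with `√−7 ∈ K`; `2 ∈ 𝔭_v`,
`ord_v 2 = 1`, `2 ∈ 𝔭_v̄`, `v̄ ≠ v`; `ι : ℚ̄₂ ≃ ℂ` pinned to `v`; `(κ₁, κ₂; γ₁, γ₂)` a generator pair of the `ℤ₂²`-tower with `κ₁` unramified
outside `v` (THE `v`-line); `θ_K` a Hecke character with `θ_K² = 1` (ANY ramification at `v`: all four classes of `θ_K|ℤ₂ˣ`).  Then there are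
Hecke characters `ρ t` (`t ∈ ℕ`) with `2`-adic avatars `r t` THROUGH `κ₁`, one-units `w, u ∈ ℂ₂` (`‖w − 1‖ < 1`, `‖u − 1‖ < ‖2‖`, `u` not a
root of unity) and `m₀ ∈ {1, 2}`, `N = 2` such that `r t (γ₁⁻¹) = w·uᵗ`, `r t (γ₂⁻¹) = 1`, `θ_K⁻¹ρ_t` has type `(−(m₀ + N t), 0)`, `ρ_t` is
unramified off `v`, `θ_K⁻¹ρ_t` is UNRAMIFIED AT `v`, and `L(θ_K⁻¹ρ_t, s)` is entire — the in-range points of every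
`IsNuBranch ι v T κ₁ γ₁⁻¹ θ_K⁻¹ …` / `IsKatzBranch ι v v̄ S κ₁ γ₁⁻¹ θ_K⁻¹ …` on the line, at a geometric progression of nodes.
Construction: the matched B18s seed `η ∈ {ω_A⁻², ω_A⁻¹ω_B⁻¹, ω_A⁻¹, ω_B⁻¹}` (cruxlead-23721 g3) times powers of `Ψ = ω_A⁻²`.
[cite: deShalit1987, II.4.12, II.4.16 (49)–(50), II.4.17 (52)–(54)] [cite: SerreAbelianLadic1968, Ch. II §2.7] [cite: IrelandRosen1982, Ch. 18 §7] -/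
theorem exists_vLineSupply (hK : IsImaginaryQuadratic K) {θ₇ : K} (hθ7 : θ₇ ^ 2 = -7)
    {v vbar : HeightOneSpectrum (𝓞 K)} (hv2 : ((2 : ℕ) : 𝓞 K) ∈ v.asIdeal) (hvbar : ((2 : ℕ) : 𝓞 K) ∈ vbar.asIdeal)
    (hne : vbar ≠ v) (h2v : v.intValuation (2 : 𝓞 K) = WithZero.exp (-1 : ℤ))
    (ι : PadicAlgCl 2 ≃+* ℂ)
    (hι : ∀ (w : InfinitePlace K) (k : 𝓞 K), k ∈ v.asIdeal ↔ ‖ι.symm (w.embedding (k : K))‖ < 1)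
    {κ₁ κ₂ : ZpExtension K 2} {γ₁ γ₂ : absoluteGaloisGroup K} (hpair : ZpExtension.IsTopGeneratorPair κ₁ κ₂ γ₁ γ₂)
    (hκ₁ : κ₁.IsUnramifiedOutside v)
    {θK : HeckeCharacter K} (hθ : θK * θK = 1) :
    ∃ (ρ : ℕ → HeckeCharacter K) (r : ℕ → FramedGaloisRep K (PadicAlgCl 2) 1) (w u : ℂ_[2]) (m₀ N : ℕ),
      0 < m₀ ∧ 0 < N ∧ ‖w - 1‖ < 1 ∧ ‖u - 1‖ < ‖(2 : ℂ_[2])‖ ∧ u ≠ 1 ∧ (∀ n : ℕ, 0 < n → u ^ n ≠ 1) ∧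
      ∀ t : ℕ,
        IsPAdicAvatarOf ι (ρ t) (r t) ∧ FactorsThroughZp κ₁ (r t) ∧ FactorsThroughPair κ₁ κ₂ (r t) ∧
        avatarValueAt (r t) γ₁⁻¹ = w * u ^ t ∧ avatarValueAt (r t) γ₂⁻¹ = 1 ∧
        0 < m₀ + N * t ∧
        (θK⁻¹ * ρ t).HasInfinityType (fun _ ↦ -((m₀ + N * t : ℕ) : ℤ)) (fun _ ↦ 0) ∧
        (∀ w' : HeightOneSpectrum (𝓞 K), w' ≠ v → (ρ t).IsUnramifiedAt w') ∧
        (θK⁻¹ * ρ t).IsUnramifiedAt v ∧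
        (∀ w' : HeightOneSpectrum (𝓞 K), w' ≠ v → θK.IsUnramifiedAt w' → (θK⁻¹ * ρ t).IsUnramifiedAt w') ∧
        LFunction.HasEntireContinuation (heckeLFunction (θK⁻¹ * ρ t)) := by
  have himag : ∀ w : InfinitePlace K, w.IsComplex := fun w ↦ hK.2.isComplex w
  -- the infinite place and the embedding `𝓞 K → ℤ₂`
  obtain ⟨w₀⟩ : Nonempty (InfinitePlace K) := inferInstance
  haveI : Subsingleton (InfinitePlace K) :=
    Fintype.card_le_one_iff_subsingleton.mp hK.card_infinitePlace_eq_one.le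
  have he : ∀ w : InfinitePlace K, w.embedding = w₀.embedding := fun w ↦ by rw [Subsingleton.elim w w₀]
  set φK : K →+* PadicAlgCl 2 := (ι.symm : ℂ ≃+* PadicAlgCl 2).toRingHom.comp w₀.embedding with hφK
  have hφKv : ∀ k : 𝓞 K, k ∈ v.asIdeal ↔ ‖φK (k : K)‖ < 1 := fun k ↦ hι w₀ k
  obtain ⟨φ₀, hφ₀⟩ := exists_intEmb hK.1 hθ7 φK
  have hφe : ∀ k : 𝓞 K, algebraMap ℚ_[2] (PadicAlgCl 2) ((φ₀ k : ℤ_[2]) : ℚ_[2]) = ι.symm (w₀.embedding (k : K)) :=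
    hφ₀
  have hvd : ∀ k : 𝓞 K, k ∈ v.asIdeal ↔ (2 : ℤ_[2]) ∣ φ₀ k := mem_iff_two_dvd_of_norm hφ₀ hφKv
  -- the two seed Größencharaktere and their inverse avatars (cruxlead-23721 g3)
  obtain ⟨ωA, ωB, ⟨hAi, hBi⟩, hU, hF, hL, hC⟩ :=
    exists_seedChar_pair hK hθ7 he hvd (ZMod.χ₈ * ZMod.χ₈') ZMod.χ₈' chi_odd.1 chi_odd.2
  have hF' : ∀ w : HeightOneSpectrum (𝓞 K), ∃ g : 𝓞 K, w ≠ v → (g ∉ v.asIdeal ∧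
      ωA.valueAtUniformizer w =
        w₀.embedding (g : K) * (((ZMod.χ₈ * ZMod.χ₈') (PadicInt.toZModPow 3 (φ₀ g)) : ℤ) : ℂ)⁻¹ ∧
      ωB.valueAtUniformizer w =
        w₀.embedding (g : K) * ((ZMod.χ₈' (PadicInt.toZModPow 3 (φ₀ g)) : ℤ) : ℂ)⁻¹) := by
    intro w
    by_cases h : w ≠ v
    · obtain ⟨g, hg⟩ := hF w h
      exact ⟨g, fun _ ↦ hg⟩
    · exact ⟨0, fun h' ↦ absurd h' h⟩
  choose g hgall using hF'
  have hg : ∀ w : HeightOneSpectrum (𝓞 K), w ≠ v → g w ∉ v.asIdeal := fun w h ↦ (hgall w h).1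
  have hgA : ∀ w : HeightOneSpectrum (𝓞 K), w ≠ v → ωA.valueAtUniformizer w =
      w₀.embedding (g w : K) * (((ZMod.χ₈ * ZMod.χ₈') (PadicInt.toZModPow 3 (φ₀ (g w))) : ℤ) : ℂ)⁻¹ :=
    fun w h ↦ (hgall w h).2.1
  have hgB : ∀ w : HeightOneSpectrum (𝓞 K), w ≠ v → ωB.valueAtUniformizer w =
      w₀.embedding (g w : K) * ((ZMod.χ₈' (PadicInt.toZModPow 3 (φ₀ (g w))) : ℤ) : ℂ)⁻¹ :=
    fun w h ↦ (hgall w h).2.2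
  obtain ⟨rA, χzA, hrA, heA, hfrA⟩ :=
    exists_unitsChar_avatar_inv ι hφe hvd ⟨_, _, hAi⟩ (fun w h ↦ (hU w h).1) hg hgA
  obtain ⟨rB, χzB, hrB, heB, hfrB⟩ :=
    exists_unitsChar_avatar_inv ι hφe hvd ⟨_, _, hBi⟩ (fun w h ↦ (hU w h).2) hg hgB
  have hfrA' : ∀ w : HeightOneSpectrum (𝓞 K), w ≠ v → ((2 : ℕ) : 𝓞 K) ∉ w.asIdeal →
      ∀ 𝔓 ∈ w.primesAbove, ∀ Φ : absoluteGaloisGroup K, IsArithFrobAt (𝓞 K) Φ 𝔓 →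
        ((χzA Φ : ℤ_[2]ˣ) : ℤ_[2]) = φ₀ (g w) *
          ((ZMod.χ₈ (PadicInt.toZModPow 3 (φ₀ (g w))) * ZMod.χ₈' (PadicInt.toZModPow 3 (φ₀ (g w))) : ℤ) : ℤ_[2]) :=
    fun w h h2 𝔓 h𝔓 Φ hΦ ↦ by rw [hfrA w h h2 𝔓 h𝔓 Φ hΦ, chi4_apply]
  have hfA : FactorsThroughPair κ₁ κ₂ rA := factorsThroughPair_of_principal hvd hK hpair heA hg hfrA'
  -- inverse seeds: unramified off `v`, types `(-1, 0)`, `(-2, 0)`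
  have hAu : ∀ w : HeightOneSpectrum (𝓞 K), w ≠ v → ωA⁻¹.IsUnramifiedAt w := fun w h ↦ (hU w h).1.inv'
  have hBu : ∀ w : HeightOneSpectrum (𝓞 K), w ≠ v → ωB⁻¹.IsUnramifiedAt w := fun w h ↦ (hU w h).2.inv'
  have hAu2 : ∀ w : HeightOneSpectrum (𝓞 K), ((2 : ℕ) : 𝓞 K) ∉ w.asIdeal → ωA⁻¹.IsUnramifiedAt w :=
    fun w hw ↦ hAu w (by rintro rfl; exact hw hv2)
  have hAt : ωA⁻¹.HasInfinityType (fun _ ↦ -((1 : ℕ) : ℤ)) (fun _ ↦ 0) := by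
    have h := hAi.inv
    have e1 : (-(fun _ ↦ 1 : InfinitePlace K → ℤ)) = fun _ ↦ -((1 : ℕ) : ℤ) := by funext w; simp
    have e2 : (-(fun _ ↦ 0 : InfinitePlace K → ℤ)) = fun _ ↦ 0 := by funext w; simp
    rw [e1, e2] at h; exact h
  have hBt : ωB⁻¹.HasInfinityType (fun _ ↦ -((1 : ℕ) : ℤ)) (fun _ ↦ 0) := by
    have h := hBi.inv
    have e1 : (-(fun _ ↦ 1 : InfinitePlace K → ℤ)) = fun _ ↦ -((1 : ℕ) : ℤ) := by funext w; simp
    have e2 : (-(fun _ ↦ 0 : InfinitePlace K → ℤ)) = fun _ ↦ 0 := by funext w; simp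
    rw [e1, e2] at h; exact h
  have htwo : ∀ {η₁ η₂ : HeckeCharacter K}, η₁.HasInfinityType (fun _ ↦ -((1 : ℕ) : ℤ)) (fun _ ↦ 0) →
      η₂.HasInfinityType (fun _ ↦ -((1 : ℕ) : ℤ)) (fun _ ↦ 0) →
      (η₁ * η₂).HasInfinityType (fun _ ↦ -((2 : ℕ) : ℤ)) (fun _ ↦ 0) := by
    intro η₁ η₂ h₁ h₂
    have h := h₁.mul' h₂
    have e1 : ((fun _ ↦ -((1 : ℕ) : ℤ)) + (fun _ ↦ -((1 : ℕ) : ℤ)) : InfinitePlace K → ℤ) =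
        fun _ ↦ -((2 : ℕ) : ℤ) := by funext w; norm_num
    have e2 : ((fun _ ↦ 0) + (fun _ ↦ 0) : InfinitePlace K → ℤ) = fun _ ↦ 0 := by funext w; simp
    rw [e1, e2] at h; exact h
  -- congruence subgroup and local values of the inverse seeds
  have hAc : ∀ q : (v.adicCompletion K)ˣ, Valued.v ((q : v.adicCompletion K) - 1) ≤ WithZero.exp (-(3 : ℤ)) →
      ωA⁻¹ (localUnits v q) = 1 := fun q hq ↦ by rw [HeckeCharacter.inv_apply, (hC q hq).1, inv_one]
  have hBc : ∀ q : (v.adicCompletion K)ˣ, Valued.v ((q : v.adicCompletion K) - 1) ≤ WithZero.exp (-(3 : ℤ)) →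
      ωB⁻¹ (localUnits v q) = 1 := fun q hq ↦ by rw [HeckeCharacter.inv_apply, (hC q hq).2, inv_one]
  have hAl : ∀ a : 𝓞 K, a ∉ v.asIdeal → ∀ ha : algebraMap K (v.adicCompletion K) (a : K) ≠ 0,
      ((ωA⁻¹ (localUnits v (Units.mk0 _ ha)) : ℂˣ) : ℂ) =
        ((((ZMod.χ₈ * ZMod.χ₈') (PadicInt.toZModPow 3 (φ₀ a))) : ℤ) : ℂ)⁻¹ := fun a ha haK ↦ by
    rw [HeckeCharacter.inv_apply, Units.val_inv_eq_inv_val, (hL a ha haK).1]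
  have hBl : ∀ a : 𝓞 K, a ∉ v.asIdeal → ∀ ha : algebraMap K (v.adicCompletion K) (a : K) ≠ 0,
      ((ωB⁻¹ (localUnits v (Units.mk0 _ ha)) : ℂˣ) : ℂ) =
        (((ZMod.χ₈' (PadicInt.toZModPow 3 (φ₀ a))) : ℤ) : ℂ)⁻¹ := fun a ha haK ↦ by
    rw [HeckeCharacter.inv_apply, Units.val_inv_eq_inv_val, (hL a ha haK).2]
  -- THE LINE: `rA`, `rB` factor through `κ₁`
  have h4A : ∀ σ, (4 : ℤ_[2]) ∣ ((χzA σ : ℤ_[2]ˣ) : ℤ_[2]) - 1 := four_dvd_sub_one_of_frobenius hvd χzA hg hfrA'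
  have hrAunr : rA.IsUnramifiedAt vbar :=
    isUnramifiedAt_avatar_of_hasInfinityType_zero ι himag hvbar hne hι hAt (T := {v})
      (fun w hw ↦ hAu w (by simpa using hw)) (hAu vbar hne) hrA
  have hκA : FactorsThroughZp κ₁ rA := factorsThroughZp_of_principal_line hK hv2 hvbar hne hpair hκ₁ heA h4A hfA hrAunr
  have hκB : FactorsThroughZp κ₁ rB := factorsThroughZp_of_rel_line hvd heA heB hg hfrA' hfrB hκA
  -- norms of the seed values at `γ₁⁻¹`
  have hwA : ‖avatarValueAt rA γ₁⁻¹ - 1‖ < ‖(2 : ℂ_[2])‖ := norm_avatarValueAt_sub_one_lt_two_of_four_dvd heA (h4A _)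
  have hwA1 : ‖avatarValueAt rA γ₁⁻¹ - 1‖ < 1 := norm_avatarValueAt_sub_one_lt_one_of_units heA _
  have hwB1 : ‖avatarValueAt rB γ₁⁻¹ - 1‖ < 1 := norm_avatarValueAt_sub_one_lt_one_of_units heB _
  have hnA : ‖avatarValueAt rA γ₁⁻¹‖ ≤ 1 := (norm_avatarValueAt_eq_one_of_lt hwA1).le
  have hnB : ‖avatarValueAt rB γ₁⁻¹‖ ≤ 1 := (norm_avatarValueAt_eq_one_of_lt hwB1).le
  have h2le : ‖(2 : ℂ_[2])‖ ≤ 1 := by rw [norm_two_padicComplex]; norm_num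
  -- the everywhere-unramified character `Ψ = ω_A⁻²` with avatar `ψ = rA ⊗ det rA` through `κ₁`
  have hψav : IsPAdicAvatarOf ι (ωA⁻¹ * ωA⁻¹) (FramedRep.twist rA (detChar rA)) := hrA.mul_twist hrA hAu2
  have hψκ : FactorsThroughZp κ₁ (FramedRep.twist rA (detChar rA)) := factorsThroughZp_twist_detChar hκA hκA
  have hΨt : (ωA⁻¹ * ωA⁻¹).HasInfinityType (fun _ ↦ -((2 : ℕ) : ℤ)) (fun _ ↦ 0) := htwo hAt hAt
  have hne' : ∀ b : 𝓞 K, b ∉ v.asIdeal → algebraMap K (v.adicCompletion K) (b : K) ≠ 0 := fun b hb h0 ↦ by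
    have h1 : Valued.v (algebraMap K (v.adicCompletion K) (b : K)) = 1 := by
      rw [Literature.NumberTheory.GaloisRepresentations.valued_algebraMap_adicCompletion,
        RingOfIntegers.coe_eq_algebraMap, HeightOneSpectrum.valuation_of_algebraMap,
        HeightOneSpectrum.intValuation_eq_one_iff.mpr hb]
    rw [h0, map_zero] at h1; exact zero_ne_one h1
  have hn1 : (-1 : 𝓞 K) ∉ v.asIdeal := rep_not_mem h2v (Or.inr (Or.inl rfl))
  have h5 : (5 : 𝓞 K) ∉ v.asIdeal := rep_not_mem h2v (Or.inr (Or.inr (Or.inl rfl)))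
  obtain ⟨t1, tn1, t5, tn5, t1', tn1', t5', tn5'⟩ := chi_table
  have hΨv : (ωA⁻¹ * ωA⁻¹).IsUnramifiedAt v := by
    have h11 : (1 : HeckeCharacter K) * 1 = 1 := one_mul 1
    have h := isUnramifiedAt_inv_mul_of_signs hvd h2v h11
      (fun t ↦ ((((ZMod.χ₈ * ZMod.χ₈') t) : ℤ) : ℂ)⁻¹ * ((((ZMod.χ₈ * ZMod.χ₈') t) : ℤ) : ℂ)⁻¹)
      (η := ωA⁻¹ * ωA⁻¹) (s₁ := 1) (s₅ := 1)
      (fun q hq ↦ by rw [HeckeCharacter.mul_apply, hAc q hq, one_mul])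
      (fun a ha haK ↦ by rw [HeckeCharacter.mul_apply, Units.val_mul, hAl a ha haK])
      (fun _ ↦ by rw [HeckeCharacter.one_apply, Units.val_one]) (fun _ ↦ by rw [HeckeCharacter.one_apply, Units.val_one])
      ?_ ?_ ?_ ?_
    · rwa [inv_one, one_mul] at h
    all_goals simp only [chi4_apply, t1, tn1, t5, tn5, t1', tn1', t5', tn5']; norm_num
  have hΨu : ∀ w : HeightOneSpectrum (𝓞 K), (ωA⁻¹ * ωA⁻¹).IsUnramifiedAt w := by
    intro w
    by_cases hw : w = v
    · rw [hw]; exact hΨv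
    · exact (hAu w hw).mul' (hAu w hw)
  have hψsmall : ‖avatarValueAt (FramedRep.twist rA (detChar rA)) γ₁⁻¹ - 1‖ < ‖(2 : ℂ_[2])‖ := by
    rw [avatarValueAt_twist_detChar]
    exact (norm_mul_sub_one_le hnA).trans_lt (max_lt hwA hwA)
  have hwAA : ‖avatarValueAt (FramedRep.twist rA (detChar rA)) γ₁⁻¹ - 1‖ < 1 := by
    rw [avatarValueAt_twist_detChar]
    exact (norm_mul_sub_one_le hnA).trans_lt (max_lt hwA1 hwA1)
  have hwBA : ‖avatarValueAt (FramedRep.twist rB (detChar rA)) γ₁⁻¹ - 1‖ < 1 := by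
    rw [avatarValueAt_twist_detChar]
    exact (norm_mul_sub_one_le hnB).trans_lt (max_lt hwA1 hwB1)
  -- the two signs of `θK` at `v`
  set s₁ : ℂ := ((θK (localUnits v (Units.mk0 _ (hne' _ hn1))) : ℂˣ) : ℂ) with hs₁def
  set s₅ : ℂ := ((θK (localUnits v (Units.mk0 _ (hne' _ h5))) : ℂˣ) : ℂ) with hs₅def
  have hs₁ : ∀ ha : algebraMap K (v.adicCompletion K) ((-1 : 𝓞 K) : K) ≠ 0,
      ((θK (localUnits v (Units.mk0 _ ha)) : ℂˣ) : ℂ) = s₁ := fun _ ↦ rfl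
  have hs₅ : ∀ ha : algebraMap K (v.adicCompletion K) ((5 : 𝓞 K) : K) ≠ 0,
      ((θK (localUnits v (Units.mk0 _ ha)) : ℂˣ) : ℂ) = s₅ := fun _ ↦ rfl
  -- the generic finish
  have finish : ∀ {η : HeckeCharacter K} {e : FramedGaloisRep K (PadicAlgCl 2) 1} {a : ℕ}, 0 < a →
      IsPAdicAvatarOf ι η e → FactorsThroughZp κ₁ e → (∀ w : HeightOneSpectrum (𝓞 K), w ≠ v → η.IsUnramifiedAt w) →
      η.HasInfinityType (fun _ ↦ -(a : ℤ)) (fun _ ↦ 0) → (θK⁻¹ * η).IsUnramifiedAt v → ‖avatarValueAt e γ₁⁻¹ - 1‖ < 1 →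
      ∃ (ρ : ℕ → HeckeCharacter K) (r : ℕ → FramedGaloisRep K (PadicAlgCl 2) 1) (w u : ℂ_[2]) (m₀ N : ℕ),
        0 < m₀ ∧ 0 < N ∧ ‖w - 1‖ < 1 ∧ ‖u - 1‖ < ‖(2 : ℂ_[2])‖ ∧ u ≠ 1 ∧ (∀ n : ℕ, 0 < n → u ^ n ≠ 1) ∧
        ∀ t : ℕ,
          IsPAdicAvatarOf ι (ρ t) (r t) ∧ FactorsThroughZp κ₁ (r t) ∧ FactorsThroughPair κ₁ κ₂ (r t) ∧
          avatarValueAt (r t) γ₁⁻¹ = w * u ^ t ∧ avatarValueAt (r t) γ₂⁻¹ = 1 ∧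
          0 < m₀ + N * t ∧
          (θK⁻¹ * ρ t).HasInfinityType (fun _ ↦ -((m₀ + N * t : ℕ) : ℤ)) (fun _ ↦ 0) ∧
          (∀ w' : HeightOneSpectrum (𝓞 K), w' ≠ v → (ρ t).IsUnramifiedAt w') ∧
          (θK⁻¹ * ρ t).IsUnramifiedAt v ∧
          (∀ w' : HeightOneSpectrum (𝓞 K), w' ≠ v → θK.IsUnramifiedAt w' → (θK⁻¹ * ρ t).IsUnramifiedAt w') ∧
          LFunction.HasEntireContinuation (heckeLFunction (θK⁻¹ * ρ t)) :=
    fun ha he heκ hηu hηt hmatch hwe ↦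
      lineSupply_of_matched hK hv2 hvbar hne hι hpair hθ ha he heκ hηu hηt hmatch hwe hψav hψκ hΨu hΨt hψsmall
  -- four cases, by the two signs of `θK` at `v`
  rcases coe_apply_eq_one_or_of_mul_self hθ (localUnits v (Units.mk0 _ (hne' _ hn1))) with e₁ | e₁ <;>
    rcases coe_apply_eq_one_or_of_mul_self hθ (localUnits v (Units.mk0 _ (hne' _ h5))) with e₅ | e₅ <;>
    rw [← hs₁def] at e₁ <;> rw [← hs₅def] at e₅
  · -- `θK|𝒪_vˣ = 1`: seed `ω_A⁻²`
    refine finish two_pos hψav hψκ (fun w h ↦ (hAu w h).mul' (hAu w h)) hΨt ?_ hwAA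
    refine isUnramifiedAt_inv_mul_of_signs hvd h2v hθ
      (fun t ↦ ((((ZMod.χ₈ * ZMod.χ₈') t) : ℤ) : ℂ)⁻¹ * ((((ZMod.χ₈ * ZMod.χ₈') t) : ℤ) : ℂ)⁻¹)
      (fun q hq ↦ by rw [HeckeCharacter.mul_apply, hAc q hq, one_mul])
      (fun a ha haK ↦ by rw [HeckeCharacter.mul_apply, Units.val_mul, hAl a ha haK]) hs₁ hs₅ ?_ ?_ ?_ ?_
    all_goals simp only [chi4_apply, t1, tn1, t5, tn5, t1', tn1', t5', tn5', e₁, e₅]; norm_num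
  · -- `θK(⟨−1⟩) = 1, θK(⟨5⟩) = −1` (`χ₈`): seed `ω_A⁻¹ω_B⁻¹`
    refine finish two_pos (hrB.mul_twist hrA hAu2) (factorsThroughZp_twist_detChar hκB hκA)
      (fun w h ↦ (hAu w h).mul' (hBu w h)) (htwo hAt hBt) ?_ hwBA
    refine isUnramifiedAt_inv_mul_of_signs hvd h2v hθ
      (fun t ↦ ((((ZMod.χ₈ * ZMod.χ₈') t) : ℤ) : ℂ)⁻¹ * (((ZMod.χ₈' t) : ℤ) : ℂ)⁻¹)
      (fun q hq ↦ by rw [HeckeCharacter.mul_apply, hAc q hq, hBc q hq, one_mul])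
      (fun a ha haK ↦ by rw [HeckeCharacter.mul_apply, Units.val_mul, hAl a ha haK, hBl a ha haK]) hs₁ hs₅ ?_ ?_ ?_ ?_
    all_goals simp only [chi4_apply, t1, tn1, t5, tn5, t1', tn1', t5', tn5', e₁, e₅]; norm_num
  · -- `θK(⟨−1⟩) = −1, θK(⟨5⟩) = 1` (`χ₄`): seed `ω_A⁻¹`
    refine finish one_pos hrA hκA hAu hAt ?_ hwA1
    refine isUnramifiedAt_inv_mul_of_signs hvd h2v hθ
      (fun t ↦ ((((ZMod.χ₈ * ZMod.χ₈') t) : ℤ) : ℂ)⁻¹) hAc hAl hs₁ hs₅ ?_ ?_ ?_ ?_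
    all_goals simp only [chi4_apply, t1, tn1, t5, tn5, t1', tn1', t5', tn5', e₁, e₅]; norm_num
  · -- `θK(⟨−1⟩) = −1, θK(⟨5⟩) = −1` (`χ₈'`): seed `ω_B⁻¹`
    refine finish one_pos hrB hκB hBu hBt ?_ hwB1
    refine isUnramifiedAt_inv_mul_of_signs hvd h2v hθ
      (fun t ↦ (((ZMod.χ₈' t) : ℤ) : ℂ)⁻¹) hBc hBl hs₁ hs₅ ?_ ?_ ?_ ?_
    all_goals simp only [t1', tn1', t5', tn5', e₁, e₅]; norm_num


/-! ## §4 The DA7 currency of line `m_line_pin`: `d_K = −7`, a framed quadratic `θ` and its Hecke avatar `θ_K` -/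

section DA7

open Literature.NumberTheory.EllipticCurves.KellerYin2024

/-- **THE `v`-LINE SUPPLY ON THE DA7 FRAME OF LINE `m_line_pin` (crux 24086), binder currency**: `K` imaginary quadratic with `d_K = −7`,
`2 = v v̄`, `ι` pinned to `v`, a generator pair with `κ₁` THE `v`-line, a framed quadratic `θ` with Hecke avatar `θ_K` — ANY ramification of `θ_K`
at `v` (the print class `χ_d ∘ N`, `d ≢ 1 (mod 4)`, is ramified at `v`).  Conclusion: the line supply of `exists_vLineSupply`.
[cite: deShalit1987, II.4.12, II.4.16 (49)–(50), II.4.17 (52)–(54)] [cite: Muller2020SplitPrimeTwo, Thm. 2.4, Def. 2.5] -/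
theorem exists_vLineSupply_of_discr (hK : IsImaginaryQuadratic K) (hdK : NumberField.discr K = -7)
    {v vbar : HeightOneSpectrum (𝓞 K)} (hv2 : ((2 : ℕ) : 𝓞 K) ∈ v.asIdeal) (hvbar : ((2 : ℕ) : 𝓞 K) ∈ vbar.asIdeal)
    (hne : vbar ≠ v) (ι : PadicAlgCl 2 ≃+* ℂ)
    (hι : ∀ (w : InfinitePlace K) (k : 𝓞 K), k ∈ v.asIdeal ↔ ‖ι.symm (w.embedding (k : K))‖ < 1)
    {κ₁ κ₂ : ZpExtension K 2} {γ₁ γ₂ : absoluteGaloisGroup K} (hpair : ZpExtension.IsTopGeneratorPair κ₁ κ₂ γ₁ γ₂)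
    (hκ₁ : κ₁.IsUnramifiedOutside v)
    {θ : FramedGaloisRep K (padicCoeffIntegers (∅ : Set (PadicAlgCl 2))) 1} (hθ2 : ∀ σ : absoluteGaloisGroup K, θ σ ^ 2 = 1)
    {θK : HeckeCharacter K} (hθK : IsHeckeCharOf ι θ θK) :
    ∃ (ρ : ℕ → HeckeCharacter K) (r : ℕ → FramedGaloisRep K (PadicAlgCl 2) 1) (w u : ℂ_[2]) (m₀ N : ℕ),
      0 < m₀ ∧ 0 < N ∧ ‖w - 1‖ < 1 ∧ ‖u - 1‖ < ‖(2 : ℂ_[2])‖ ∧ u ≠ 1 ∧ (∀ n : ℕ, 0 < n → u ^ n ≠ 1) ∧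
      ∀ t : ℕ,
        IsPAdicAvatarOf ι (ρ t) (r t) ∧ FactorsThroughZp κ₁ (r t) ∧ FactorsThroughPair κ₁ κ₂ (r t) ∧
        avatarValueAt (r t) γ₁⁻¹ = w * u ^ t ∧ avatarValueAt (r t) γ₂⁻¹ = 1 ∧
        0 < m₀ + N * t ∧
        (θK⁻¹ * ρ t).HasInfinityType (fun _ ↦ -((m₀ + N * t : ℕ) : ℤ)) (fun _ ↦ 0) ∧
        (∀ w' : HeightOneSpectrum (𝓞 K), w' ≠ v → (ρ t).IsUnramifiedAt w') ∧
        (θK⁻¹ * ρ t).IsUnramifiedAt v ∧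
        (∀ w' : HeightOneSpectrum (𝓞 K), w' ≠ v → θK.IsUnramifiedAt w' → (θK⁻¹ * ρ t).IsUnramifiedAt w') ∧
        LFunction.HasEntireContinuation (heckeLFunction (θK⁻¹ * ρ t)) := by
  -- `√−7 ∈ K` and `ord_v 2 = 1` (the road-α curve datum instantiated at `W := cm7^{(1)}`, as in cf2c-w2/cf2c-w8's files)
  obtain ⟨θ₇, hθ7⟩ := VLineCharIdeal.exists_sq_eq_neg_seven hK.1 hdK
  haveI : (cm7.quadraticTwist ((1 : ℤ) : ℚ)).IsElliptic := cm7.isElliptic_quadraticTwist (by norm_num)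
  have hCW : (1 : WeierstrassCurve.VariableChange ℚ) • cm7.quadraticTwist ((1 : ℤ) : ℚ) = cm7.quadraticTwist ((1 : ℤ) : ℚ) := one_smul _ _
  have h2v : v.intValuation (2 : 𝓞 K) = WithZero.exp (-1 : ℤ) :=
    FirstLayer.intValuation_two_of_frame hK hθ7 one_ne_zero (cm7.quadraticTwist ((1 : ℤ) : ℚ)) hCW hv2
  exact exists_vLineSupply hK hθ7 hv2 hvbar hne h2v ι hι hpair hκ₁ (KatzPeriodRigidity.mul_self_eq_one_of_isHeckeCharOf_quadratic ι hθ2 hθK)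

/-- **The 7-conjunct projection** of `exists_vLineSupply_of_discr` — EXACTLY the hypothesis `hsupply` of ty2 g36's (A) glue
`VLineRestriction.vLineRestriction_of_supply` (this seat's 08:11Z STATUS print). [cite: deShalit1987, II.4.16 (49)–(50), II.4.17 (52)–(54)] -/
theorem exists_vLineSupply_of_discr_proj (hK : IsImaginaryQuadratic K) (hdK : NumberField.discr K = -7)
    {v vbar : HeightOneSpectrum (𝓞 K)} (hv2 : ((2 : ℕ) : 𝓞 K) ∈ v.asIdeal) (hvbar : ((2 : ℕ) : 𝓞 K) ∈ vbar.asIdeal)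
    (hne : vbar ≠ v) (ι : PadicAlgCl 2 ≃+* ℂ)
    (hι : ∀ (w : InfinitePlace K) (k : 𝓞 K), k ∈ v.asIdeal ↔ ‖ι.symm (w.embedding (k : K))‖ < 1)
    {κ₁ κ₂ : ZpExtension K 2} {γ₁ γ₂ : absoluteGaloisGroup K} (hpair : ZpExtension.IsTopGeneratorPair κ₁ κ₂ γ₁ γ₂)
    (hκ₁ : κ₁.IsUnramifiedOutside v)
    {θ : FramedGaloisRep K (padicCoeffIntegers (∅ : Set (PadicAlgCl 2))) 1} (hθ2 : ∀ σ : absoluteGaloisGroup K, θ σ ^ 2 = 1)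
    {θK : HeckeCharacter K} (hθK : IsHeckeCharOf ι θ θK) :
    ∃ (ρ : ℕ → HeckeCharacter K) (r : ℕ → FramedGaloisRep K (PadicAlgCl 2) 1) (w u : ℂ_[2]) (m₀ N : ℕ),
      0 < m₀ ∧ 0 < N ∧ ‖w - 1‖ < 1 ∧ ‖u - 1‖ < ‖(2 : ℂ_[2])‖ ∧ u ≠ 1 ∧
      ∀ t : ℕ,
        IsPAdicAvatarOf ι (ρ t) (r t) ∧ FactorsThroughZp κ₁ (r t) ∧ avatarValueAt (r t) γ₁⁻¹ = w * u ^ t ∧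
        (θK⁻¹ * ρ t).HasInfinityType (fun _ ↦ -((m₀ + N * t : ℕ) : ℤ)) (fun _ ↦ 0) ∧
        (∀ w' : HeightOneSpectrum (𝓞 K), w' ≠ v → (ρ t).IsUnramifiedAt w') ∧
        (θK⁻¹ * ρ t).IsUnramifiedAt v ∧
        LFunction.HasEntireContinuation (heckeLFunction (θK⁻¹ * ρ t)) := by
  obtain ⟨ρ, r, w, u, m₀, N, hm₀, hN, hw, hu, hu1, -, hall⟩ :=
    exists_vLineSupply_of_discr hK hdK hv2 hvbar hne ι hι hpair hκ₁ hθ2 hθK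
  exact ⟨ρ, r, w, u, m₀, N, hm₀, hN, hw, hu, hu1, fun t ↦
    ⟨(hall t).1, (hall t).2.1, (hall t).2.2.2.1, (hall t).2.2.2.2.2.2.1, (hall t).2.2.2.2.2.2.2.1, (hall t).2.2.2.2.2.2.2.2.1,
      (hall t).2.2.2.2.2.2.2.2.2.2⟩⟩

end DA7

/-! ## §5 Consumer forms: the modulus bookkeeping and the inner-line restriction of a two-variable frame -/

section Consumer

open Literature.NumberTheory.EllipticCurves.Muller2020

/-- **Modulus bookkeeping**: a supply point `ε = θ_K⁻¹ρ` (unramified at `v`; unramified at every `w ≠ v` where `θ_K` is) is unramified outside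
every finite set `T` that contains the ramification of `θ_K` away from `v` — the hypothesis `hunr` of `IsNuBranch.hasValueAt` /
`DeShalit1987.IsKatzBranch.hasValueAt` for the moduli `T = S`, `S ∪ {v̄}`. [cite: Muller2020SplitPrimeTwo, Thm. 2.4, Def. 2.5] -/
theorem isUnramifiedAt_of_modulus {v : HeightOneSpectrum (𝓞 K)} {θK ρ : HeckeCharacter K}
    (hv : (θK⁻¹ * ρ).IsUnramifiedAt v)
    (hcomb : ∀ w' : HeightOneSpectrum (𝓞 K), w' ≠ v → θK.IsUnramifiedAt w' → (θK⁻¹ * ρ).IsUnramifiedAt w')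
    {T : Finset (HeightOneSpectrum (𝓞 K))} (hT : ∀ w : HeightOneSpectrum (𝓞 K), w ∉ T → w ≠ v → θK.IsUnramifiedAt w) :
    ∀ w : HeightOneSpectrum (𝓞 K), w ∉ T → (θK⁻¹ * ρ).IsUnramifiedAt w := by
  intro w hw
  by_cases hwv : w = v
  · rw [hwv]; exact hv
  · exact hcomb w hwv (hT w hw hwv)

variable {ι : PadicAlgCl 2 ≃+* ℂ} {v vbar : HeightOneSpectrum (𝓞 K)} {S : Finset (HeightOneSpectrum (𝓞 K))}
  {κ₁ κ₂ : ZpExtension K 2} {γ₁ γ₂ : absoluteGaloisGroup K} {lam : HeckeCharacter K} {Ω δ : ℂ} {Ωp : ℂ_[2]}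
  {G : PowerSeries (PowerSeries (PadicComplexInt 2))}

/-- **The inner-line restriction `π_v G₂ = G₂(T₁, 0)` of a two-variable frame at the inverse generators is a `ν`-branch of modulus `S ∪ {v̄}` on
THE `v`-line** (de Shalit II.4.17 (54) at `s₂ = 0`, then II.4.12 (31) = II.4.16 (50) at `j = 0`): the tree's `IsKatzMeasure₂.isKatzBranch_map_constantCoeff`
(with `κ₁ γ₂⁻¹ = 1` from the pair) followed by `IsKatzBranch.isNuBranch`.  Its values at the supply nodes are then read by `IsNuBranch.hasValueAt`.
[cite: deShalit1987, II.4.17 (52)–(54), II.4.16 (50), II Thm. 4.12 (31)] -/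
theorem isNuBranch_map_constantCoeff_of_pair (hpair : ZpExtension.IsTopGeneratorPair κ₁ κ₂ γ₁ γ₂)
    (hG : IsKatzMeasure₂ ι v vbar S κ₁ κ₂ γ₁⁻¹ γ₂⁻¹ lam Ω δ Ωp G) :
    IsNuBranch ι v (insert vbar S) κ₁ γ₁⁻¹ lam Ω Ωp (PowerSeries.map (PowerSeries.constantCoeff (R := PadicComplexInt 2)) G) :=
  (hG.isKatzBranch_map_constantCoeff (ZpExtension.mem_kerSubgroup.mp (κ₁.kerSubgroup.inv_mem hpair.2.2.1))).isNuBranch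

end Consumer

end Summit.BirchSwinnertonDyer.BirchSwinnertonDyer.Theorems.PrintCf2.VLineSupply


end
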